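import Summits.AtomisticToContinuum.FouriersLaw.Theses.OddSectorIrreversibility
import Summits.AtomisticToContinuum.FouriersLaw.Theorems.OddResponseBound.Negative.OddPairing
import Literature.MathematicalPhysics.KineticTheory.LangevinChainGibbs

/-!
# Disproof workfile for crux `ConeScaleCorrector` (E1, stmt-AtomisticToContinuum-14069) — findings

E1: `∀ ω₂ lam β γ > 0, ∀ T > 0, ∃ C, ∀ N, ∀ u` = a.e.-limit of the finite-horizon Kubo correctors
`u_τ = ∫₀^τ P_t J_tot dt` of the OPEN chain (both baths at `T`, honest kernels `transitionKernel N T T`):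
`u ∈ L²(μ_T)` and `∫ u² dμ_T ≤ C · N² · Z` (`μ_T = e^{−H/T}dqdp`, `Z` its mass). Standing disprover
(refuter-cdisprove seat), cycle 1, 2026-08-16. VERDICT SO FAR: **no kill; resists for the standard reason
(open either way); the seat's own numerics SUPPORT E1 at true scale `N²` (§6)** — details §5–§6. Provers: read §2b, §3, §5, §6 first.

## Index (everything below is sorry-free, standard axioms, `lean check` rc 0)
* §0 vocabulary (`gibbsWeight`, `Zmass`, `Jtot`, `IsCorrectorLimit`, `ConeScaleCorrectorPow k`) and the
  probe `coneScaleCorrector_iff_pow_two : ConeScaleCorrector ↔ ConeScaleCorrectorPow 2` (`Iff.rfl`):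
  elaborates; readback = the planner's text; no Bochner junk can make it false (kernels are the honest
  law of the SDE flow, `pinnedChain_transitionKernel_apply`; `Z ∈ (0,∞)` for `T > 0`; `u` pinned a.e.).
* §1 `coneScaleCorrector_slice_le_one`: `N ≤ 1` ⇒ `J_tot ≡ 0` ⇒ `u = 0` a.e. ⇒ TRUE for every `C ≥ 0`
  (no degenerate kill; independently re-proves the rattack seat's Evidence.lean).
* §2 LOAD-BEARING hypotheses:
  - §2a `coneScaleCorrector_false_without_correctorHyp`: drop the corrector predicate ⇒ false
    (`u ≡ |C|+1`, `N = 1`). Formal "the predicate is used".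
  - §2b `harmonic_corrector_exceeds` (UNCONDITIONAL): on the RLL chain, for every `C`, all large `N` and
    every `u ∈ L²` pairing with `J_tot` by the harmonic Green–Kubo value `(N−1)²c_N Z` while
    `∫J² ≤ KNZ`: `∫u² > C N² Z` (Green–Kubo floor + ballistic flux `c_N → c_∞ > 0`, PROVED in tree ⇒
    `∫u² ≳ N³Z`); hence `coneScaleCorrector_false_without_anharmonicity_of`: weakening `0 < lam, 0 < β`
    to `≥ 0` is false MODULO the Gaussian inputs H0 (corrector exists), H1 (its GK identity), H2 (linear
    current variance). Exponent 3, not 2; no spectral asymptotics of the corrector needed.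
* §3 TIGHTNESS from below `corrector_normSq_gk_floor` / `corrector_normSq_ge_of_greenKubo`:
  `∫u² ≥ (N−1)²T⁴D_N²Z/(KN)` — under Fourier (`D_N → κ > 0`) the exponent is `≥ 1`; E1's `2` is exactly
  one power above the Green–Kubo floor (that power = the deterministic causal window).
* §4 SHAPE OF A KILL `coneScaleCorrectorPow_false_of_floor`: an equilibrium floor `c N^{k+1} Z ≤ ∫u²`
  (+ existence) at ONE admissible point kills `Pow k`; `k = 2`: `coneScaleCorrector_false_of_cubicFloor`
  (kill criterion (a′) of the route); `k = 1`: the "stochastic-bulk" strengthening `Pow 1` dies under the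
  route's OWN cone floor `N²` (`coneScaleCorrectorLinear_false_of_coneFloor`) — E1 is stated at the weakest
  exponent compatible with its own heuristic, and `Pow 1` (which alone would give bounded response by one
  Cauchy–Schwarz) must NOT be attempted.
* §5 WHY IT RESISTS + `echo_identity`: `‖u‖²_π = −⟨J, RΘRJ⟩` (flip-echo of the current); E1 ⟺ the two
  boundary taps destroy the current's Loschmidt echo of the deterministic bulk within `O(1)` causal
  crossings in `L²(Gibbs)`-mean. Predicted constant `C(T) ≈ κ(T)T²/(2v_B)`.
* NUMERICS (kill criterion (a′), this seat): replica estimator `B(τ) = E[Y¹_τ Y²_τ] = ‖u_τ‖²_π`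
  (two bath-noise replicas from one Gibbs sample; `‖u‖² ≥ B(τ)/4` for every `τ` since `P_τ` contracts
  `L²(π)`), kit jobs j011336–j011341 (hot point `(1,1,1,1), T = 10`, `N = 16…512`), j011342–j011345
  (`(1,1,0.1,1), T = 8`, `N = 32…256`), j011347–j011349 (harmonic control, must show `B/N² ∝ N`);
  evidence `compute-<id>.json` on the item. READING RULE: E1 ⇔ the plateau of `B(τ)/N²` is `N`-independent;
  `B/N² ∝ N` at the hot point for `N ≫ ℓ(T)` would be kill (a′) (then §4 with `k+1 = 3`). RESULTS §6:
  at the hot point the plateau IS `N`-independent (`850 ± 136`, `924 ± 104`, `790 ± 164` for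
  `N = 128, 256, 512` and `860 ± 100` at `N = 1024`: FLAT over a factor 8, = σ²_∞/(4v_B) as §5 predicts;
  small-N slopes 3.35 → 1.68 track the converging GK integral), reached in ONE causal crossing; second
  point `(1,1,0.1,1), T = 8`: plateau `52 ± 5` FLAT for `N = 32…256` (slope 1.95); harmonic control slope
  2.98 — E1 survives (a′) numerically at both asymptotic anharmonic points, no loophole at the 12 % level;
  the cold point `T = 1` is pre-asymptotic to `N = 256` (B tracks the unconverged GK integral).

## Census of attacks (cycle 1)
degenerate `N ≤ 1` (true) · junk hunt in kernels / `toNNReal` / Bochner zeros / `withDensity` (none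
bites; `MemLp` conjunct true at fixed `N` by CEHR e^{θH}-weighted ergodicity, θ < 1/(2T)) · `T → 0`,
`lam, β → 0` corners (absorbed by `∃ C(T, lam, β)`; exact ALS scaling conjugacy maps cold to weakly
anharmonic, no contradiction) · harmonic member (false, exponent 3, §2b) · `γ = 0` (vacuous: closed-chain
`u_τ = G∘Φ_τ − G` has no a.e. limit) · barrier catalogue (HasBoundedResponse: E1 alone does not give it;
SpectralGapClosing / equilibrium_rate_bound: E1 is one vector, no rate; StrongPinningBreathers: φ⁴ with
harmonic coupling only; Mazur/open-chain: no odd conserved quantity in the family) · ledger negatives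
(12; none on correctors) · literature: searchd DEGRADED (rc 75) this cycle; galaxy: classical OTOC /
butterfly fronts in nonlinear chains are ballistic (Chatterjee–Kundu–Kulkarni arXiv:2002.05629; Malishava–
Flach PRL 128 (2022) Lyapunov spectrum scaling near integrability — the cold corner), nothing printed on
the corrector norm of a boundary-driven deterministic chain.
-/

noncomputable section

namespace Summit.AtomisticToContinuum.FouriersLaw.Cruxes.ConeScaleCorrector.Disproof

open MeasureTheory Filter Topology Set
open Literature.MathematicalPhysics.KineticTheory.HeatConduction
open Summit.AtomisticToContinuum.FouriersLaw.Theses.OddSectorIrreversibility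
open Summit.AtomisticToContinuum.FouriersLaw.Theorems.OddResponseBound.Negative.OddPairing

/-! ## §0 vocabulary and the probe -/

/-- The unnormalised Gibbs weight `μ_T = e^{-H/T} · Lebesgue` of the chain `P` (the crux's `μT`). -/
def gibbsWeight (P : OscillatorChain) (N : ℕ) (T : ℝ) : Measure (PhaseSpace N) :=
  volume.withDensity fun x : PhaseSpace N => ENNReal.ofReal (Real.exp (-(P.hamiltonian N x) / T))

/-- Its mass `Z = ∫ e^{-H/T}` as a real Bochner integral (the crux's right-hand normalisation). -/
def Zmass (P : OscillatorChain) (N : ℕ) (T : ℝ) : ℝ :=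
  ∫ x : PhaseSpace N, Real.exp (-(P.hamiltonian N x) / T)

/-- The total current `J_tot = Σ_i j_i` (the last "bond" `i = N-1` is the phantom `0`). -/
def Jtot (P : OscillatorChain) (N : ℕ) : PhaseSpace N → ℝ := fun z => ∑ i : Fin N, P.bondCurrent N i z

/-- The crux's corrector predicate: `u` is a `μ_T`-a.e. limit, as `τ → ∞`, of the finite-horizon Kubo
correctors `u_τ(x) = ∫₀^τ (P_t J_tot)(x) dt` of the OPEN chain with both baths at `T`. -/
def IsCorrectorLimit (P : OscillatorChain) (N : ℕ) (T : ℝ) (u : PhaseSpace N → ℝ) : Prop :=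
  ∀ᵐ x ∂(gibbsWeight P N T), Tendsto (fun τ : ℝ => ∫ t in Set.Ioc (0 : ℝ) τ,
    (∫ y, Jtot P N y ∂(P.transitionKernel N T T t.toNNReal x))) atTop (𝓝 (u x))

/-- `ConeScaleCorrectorPow k`: the crux with the power `N²` replaced by `N^k` (`k = 2` is E1 itself,
`k = 1` the "stochastic-bulk" strengthening, `k = 3` the harmonic truth). -/
def ConeScaleCorrectorPow (k : ℕ) : Prop :=
  ∀ ω₂ lam β γ : ℝ, 0 < ω₂ → 0 < lam → 0 < β → 0 < γ → ∀ T : ℝ, 0 < T → ∃ C : ℝ,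
    ∀ (N : ℕ) (u : PhaseSpace N → ℝ), IsCorrectorLimit (pinnedChain ω₂ lam β γ) N T u →
      MemLp u 2 (gibbsWeight (pinnedChain ω₂ lam β γ) N T) ∧
        ∫ x, (u x) ^ 2 ∂(gibbsWeight (pinnedChain ω₂ lam β γ) N T) ≤
          C * (N : ℝ) ^ k * Zmass (pinnedChain ω₂ lam β γ) N T

/-- PROBE (rc 0): the crux elaborates and is, verbatim up to the abbreviations above, the `k = 2`
member of the family. -/
theorem coneScaleCorrector_iff_pow_two : ConeScaleCorrector ↔ ConeScaleCorrectorPow 2 := Iff.rfl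

/-! ## §1 degenerate slice `N ≤ 1`: TRUE for every `C ≥ 0` (no degenerate kill) -/

/-- For `N ≤ 1` there is no bond: `J_tot ≡ 0`. -/
theorem Jtot_eq_zero_of_le_one (P : OscillatorChain) {N : ℕ} (hN : N ≤ 1) (z : PhaseSpace N) :
    Jtot P N z = 0 := by
  unfold Jtot OscillatorChain.bondCurrent
  refine Finset.sum_eq_zero fun i _ => Finset.sum_eq_zero fun j _ => ?_
  have hi := i.isLt
  have hj := j.isLt
  rw [if_neg (by omega)]

/-- `Z ≥ 0`. -/
theorem Zmass_nonneg (P : OscillatorChain) (N : ℕ) (T : ℝ) : 0 ≤ Zmass P N T :=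
  integral_nonneg fun _ => (Real.exp_pos _).le

/-- **Degenerate slice.** For `N ≤ 1` the corrector predicate forces `u = 0` a.e. (the integrand is
`0`), so the `N`-instance of E1 holds for every `C ≥ 0` and every parameter value: no refutation at
`N = 0, 1`. -/
theorem coneScaleCorrector_slice_le_one (P : OscillatorChain) {N : ℕ} (hN : N ≤ 1) (T : ℝ) {C : ℝ}
    (hC : 0 ≤ C) (k : ℕ) (u : PhaseSpace N → ℝ) (hu : IsCorrectorLimit P N T u) :
    MemLp u 2 (gibbsWeight P N T) ∧
      ∫ x, (u x) ^ 2 ∂(gibbsWeight P N T) ≤ C * (N : ℝ) ^ k * Zmass P N T := by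
  have hu0 : u =ᵐ[gibbsWeight P N T] 0 := by
    filter_upwards [hu] with x hx
    have h0 : (fun τ : ℝ => ∫ t in Set.Ioc (0 : ℝ) τ,
        (∫ y, Jtot P N y ∂(P.transitionKernel N T T t.toNNReal x))) = fun _ => 0 := by
      funext τ
      simp [Jtot_eq_zero_of_le_one P hN]
    rw [h0] at hx
    exact tendsto_nhds_unique hx tendsto_const_nhds
  have hz : MemLp (0 : PhaseSpace N → ℝ) 2 (gibbsWeight P N T) := MemLp.zero
  refine ⟨hz.ae_eq hu0.symm, ?_⟩
  have h1 : ∫ x, (u x) ^ 2 ∂(gibbsWeight P N T) = 0 := by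
    have : (fun x => (u x) ^ 2) =ᵐ[gibbsWeight P N T] fun _ => (0 : ℝ) := by
      filter_upwards [hu0] with x hx
      simp [hx]
    rw [integral_congr_ae this, integral_zero]
  rw [h1]
  have := Zmass_nonneg P N T
  positivity

/-! ## §2 load-bearing hypotheses -/

/-! ### §2a the corrector predicate is used (dropping it leaves a false statement about all of `L²`) -/

/-- E1 with the corrector predicate DROPPED: a bound on every `u`. -/
def ConeScaleCorrectorWithoutCorrectorHyp : Prop :=
  ∀ ω₂ lam β γ : ℝ, 0 < ω₂ → 0 < lam → 0 < β → 0 < γ → ∀ T : ℝ, 0 < T → ∃ C : ℝ,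
    ∀ (N : ℕ) (u : PhaseSpace N → ℝ),
      MemLp u 2 (gibbsWeight (pinnedChain ω₂ lam β γ) N T) ∧
        ∫ x, (u x) ^ 2 ∂(gibbsWeight (pinnedChain ω₂ lam β γ) N T) ≤
          C * (N : ℝ) ^ 2 * Zmass (pinnedChain ω₂ lam β γ) N T

section Mass

variable {ω₂ lam β : ℝ}

/-- `0 < Z < ∞` bookkeeping: the Gibbs weight is integrable for `T > 0` (tree:
`pinnedChain_integrable_gibbsDensity`). -/
theorem integrable_weight (hω : 0 < ω₂) (hl : 0 ≤ lam) (hβ : 0 ≤ β) (γ : ℝ) (N : ℕ) {T : ℝ}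
    (hT : 0 < T) :
    Integrable fun x : PhaseSpace N => Real.exp (-((pinnedChain ω₂ lam β γ).hamiltonian N x) / T) :=
  pinnedChain_integrable_gibbsDensity hω hl hβ γ N hT

/-- `Z > 0`. -/
theorem Zmass_pos (hω : 0 < ω₂) (hl : 0 ≤ lam) (hβ : 0 ≤ β) (γ : ℝ) (N : ℕ) {T : ℝ} (hT : 0 < T) :
    0 < Zmass (pinnedChain ω₂ lam β γ) N T :=
  integral_exp_pos (integrable_weight hω hl hβ γ N hT)

/-- The total mass of the Gibbs weight is `Z`. -/
theorem gibbsWeight_univ_toReal (hω : 0 < ω₂) (hl : 0 ≤ lam) (hβ : 0 ≤ β) (γ : ℝ) (N : ℕ) {T : ℝ}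
    (hT : 0 < T) :
    ((gibbsWeight (pinnedChain ω₂ lam β γ) N T) Set.univ).toReal = Zmass (pinnedChain ω₂ lam β γ) N T := by
  rw [gibbsWeight, withDensity_apply _ MeasurableSet.univ, Measure.restrict_univ, Zmass,
    integral_eq_lintegral_of_nonneg_ae (Eventually.of_forall fun x => (Real.exp_pos _).le)
      (integrable_weight hω hl hβ γ N hT).aestronglyMeasurable]

/-- Integral of a constant against the Gibbs weight. -/
theorem integral_const_gibbsWeight (hω : 0 < ω₂) (hl : 0 ≤ lam) (hβ : 0 ≤ β) (γ : ℝ) (N : ℕ)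
    {T : ℝ} (hT : 0 < T) (c : ℝ) :
    ∫ _x, c ∂(gibbsWeight (pinnedChain ω₂ lam β γ) N T) = c * Zmass (pinnedChain ω₂ lam β γ) N T := by
  rw [integral_const, smul_eq_mul, Measure.real, gibbsWeight_univ_toReal hω hl hβ γ N hT, mul_comm]

end Mass

/-- **Any proof of E1 must use the corrector predicate**: without it the statement bounds every
function; the constant `u ≡ |C| + 1` at `N = 1` breaks it (`∫ u² dμ_T = (|C|+1)² Z > C · Z`). -/
theorem coneScaleCorrector_false_without_correctorHyp : ¬ ConeScaleCorrectorWithoutCorrectorHyp := by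
  intro h
  obtain ⟨C, hC⟩ := h 1 1 1 1 one_pos one_pos one_pos one_pos 1 one_pos
  obtain ⟨_, hle⟩ := hC 1 fun _ => |C| + 1
  have hZ := Zmass_pos one_pos zero_le_one zero_le_one (1 : ℝ) 1 one_pos
  rw [integral_const_gibbsWeight one_pos zero_le_one zero_le_one 1 1 one_pos] at hle
  have h1 : C < (|C| + 1) ^ 2 := by
    rcases le_or_gt 0 C with h0 | h0
    · rw [abs_of_nonneg h0]; nlinarith
    · have := sq_nonneg (|C| + 1); linarith
  have h2 : C * ((1 : ℕ) : ℝ) ^ 2 * Zmass (pinnedChain 1 1 1 1) 1 1 = C * Zmass (pinnedChain 1 1 1 1) 1 1 := by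
    norm_num
  rw [h2] at hle
  nlinarith


/-! ### §2b anharmonicity: the harmonic member `lam = β = 0` fails with exponent `3`, by Green–Kubo alone -/

/-- E1 with `0 < lam`, `0 < β` WEAKENED to `0 ≤ lam`, `0 ≤ β`. FALSE (at `lam = β = 0`, below). -/
def ConeScaleCorrectorWithoutAnharmonicity : Prop :=
  ∀ ω₂ lam β γ : ℝ, 0 < ω₂ → 0 ≤ lam → 0 ≤ β → 0 < γ → ∀ T : ℝ, 0 < T → ∃ C : ℝ,
    ∀ (N : ℕ) (u : PhaseSpace N → ℝ), IsCorrectorLimit (pinnedChain ω₂ lam β γ) N T u →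
      MemLp u 2 (gibbsWeight (pinnedChain ω₂ lam β γ) N T) ∧
        ∫ x, (u x) ^ 2 ∂(gibbsWeight (pinnedChain ω₂ lam β γ) N T) ≤
          C * (N : ℝ) ^ 2 * Zmass (pinnedChain ω₂ lam β γ) N T

/-- The harmonic member of E1 (`pinnedChain ω₂ 0 0 γ`: RLL chain between Langevin baths). -/
def ConeScaleCorrectorHarmonic (ω₂ γ : ℝ) : Prop :=
  ∀ T : ℝ, 0 < T → ∃ C : ℝ, ∀ (N : ℕ) (u : PhaseSpace N → ℝ),
    IsCorrectorLimit (pinnedChain ω₂ 0 0 γ) N T u →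
      MemLp u 2 (gibbsWeight (pinnedChain ω₂ 0 0 γ) N T) ∧
        ∫ x, (u x) ^ 2 ∂(gibbsWeight (pinnedChain ω₂ 0 0 γ) N T) ≤
          C * (N : ℝ) ^ 2 * Zmass (pinnedChain ω₂ 0 0 γ) N T

/-- The weakened crux contains the harmonic member. -/
theorem coneScaleCorrectorHarmonic_of_without (h : ConeScaleCorrectorWithoutAnharmonicity) {ω₂ γ : ℝ}
    (hω : 0 < ω₂) (hγ : 0 < γ) : ConeScaleCorrectorHarmonic ω₂ γ :=
  fun T hT => h ω₂ 0 0 γ hω le_rfl le_rfl hγ T hT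

/-- INPUT H0 (harmonic twin of route item CorrectorTheory, clause A(3)): the Kubo corrector of the
harmonic open chain exists for `N ≥ 2` — a.e. (indeed everywhere) convergence of `∫₀^τ P_t J_tot dt`,
from exponential stability of the drift matrix of the linear SDE (`IsHurwitz`, in tree for the RLL
covariance) — not yet in tree at the level of the constructed kernels `transitionKernel`. -/
def HarmonicCorrectorExists (ω₂ γ : ℝ) : Prop :=
  ∀ T : ℝ, 0 < T → ∀ N : ℕ, 2 ≤ N → ∃ u : PhaseSpace N → ℝ, IsCorrectorLimit (pinnedChain ω₂ 0 0 γ) N T u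

/-- INPUT H1 (harmonic twin of CorrectorTheory clause B = the open-chain Green–Kubo identity
`⟨u, J_tot⟩_π = (N−1) T² D_N`, KunduDharNarayan2009 (reln1)–(reln3), written against the unnormalised
weight): for the RLL chain `D_N = (N−1)·fluxCoeff ω₂ γ N` EXACTLY (every bond carries
`fluxCoeff · (T_L − T_R)`, tree: `integral_bondCurrent_harmonicNESS_eq_fluxCoeff`), so
`∫ u J_tot dμ_T = (N−1) T² ((N−1) fluxCoeff) · Z`. Gaussian/Lyapunov-equation content, not in tree. -/
def HarmonicCorrectorGreenKubo (ω₂ γ : ℝ) : Prop :=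
  ∀ T : ℝ, 0 < T → ∀ N : ℕ, 2 ≤ N → ∀ u : PhaseSpace N → ℝ,
    IsCorrectorLimit (pinnedChain ω₂ 0 0 γ) N T u →
      MemLp u 2 (gibbsWeight (pinnedChain ω₂ 0 0 γ) N T) ∧
      MemLp (Jtot (pinnedChain ω₂ 0 0 γ) N) 2 (gibbsWeight (pinnedChain ω₂ 0 0 γ) N T) ∧
      ∫ x, u x * Jtot (pinnedChain ω₂ 0 0 γ) N x ∂(gibbsWeight (pinnedChain ω₂ 0 0 γ) N T) =
        ((N : ℝ) - 1) * T ^ 2 * (((N : ℝ) - 1) * fluxCoeff ω₂ γ N) * Zmass (pinnedChain ω₂ 0 0 γ) N T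

/-- INPUT H2 (harmonic twin of the dropped support CurrentVarianceLinear): the equilibrium total-current
variance is at most linear in `N`: `∫ J_tot² dμ_T ≤ K N Z` (nearest-neighbour bond currents are
uncorrelated beyond distance 1 in the product-Gaussian momenta; a fourth Gaussian moment). -/
def HarmonicTotalCurrentVariance (ω₂ γ : ℝ) : Prop :=
  ∀ T : ℝ, 0 < T → ∃ K : ℝ, ∀ N : ℕ,
    ∫ x, Jtot (pinnedChain ω₂ 0 0 γ) N x ^ 2 ∂(gibbsWeight (pinnedChain ω₂ 0 0 γ) N T) ≤
      K * (N : ℝ) * Zmass (pinnedChain ω₂ 0 0 γ) N T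

/-- **Unconditional core of the harmonic failure.** For the RLL chain and ANY prescribed constant `C`:
for all large `N`, every `u ∈ L²(μ_T)` (`T = 1`) that pairs with `J_tot` by the harmonic Green–Kubo
value `∫ u J_tot dμ = (N−1)·1²·((N−1) c_N)·Z` violates `∫ u² ≤ C N² Z` as soon as `∫ J_tot² ≤ K N Z`.
Mechanism: Cauchy–Schwarz `(∫uJ)² ≤ ∫u²·∫J²` and the ballistic flux `c_N → c_∞ > 0`
(`tendsto_fluxCoeff`, `fluxLimit_pos`, PROVED in tree) give `∫u² ≥ (N−1)⁴c_N²Z/(KN) ≍ N³Z`.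
No existence statement and no spectral asymptotics of the corrector are involved. -/
theorem harmonic_corrector_exceeds {ω₂ γ : ℝ} (hω : 0 < ω₂) (hγ : 0 < γ) (C K : ℝ) :
    ∃ N₀ : ℕ, ∀ N : ℕ, N₀ ≤ N → ∀ u : PhaseSpace N → ℝ,
      MemLp u 2 (gibbsWeight (pinnedChain ω₂ 0 0 γ) N 1) →
      MemLp (Jtot (pinnedChain ω₂ 0 0 γ) N) 2 (gibbsWeight (pinnedChain ω₂ 0 0 γ) N 1) →
      ∫ x, u x * Jtot (pinnedChain ω₂ 0 0 γ) N x ∂(gibbsWeight (pinnedChain ω₂ 0 0 γ) N 1) =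
        ((N : ℝ) - 1) * 1 ^ 2 * (((N : ℝ) - 1) * fluxCoeff ω₂ γ N) * Zmass (pinnedChain ω₂ 0 0 γ) N 1 →
      ∫ x, Jtot (pinnedChain ω₂ 0 0 γ) N x ^ 2 ∂(gibbsWeight (pinnedChain ω₂ 0 0 γ) N 1) ≤
        K * (N : ℝ) * Zmass (pinnedChain ω₂ 0 0 γ) N 1 →
      C * (N : ℝ) ^ 2 * Zmass (pinnedChain ω₂ 0 0 γ) N 1 <
        ∫ x, u x ^ 2 ∂(gibbsWeight (pinnedChain ω₂ 0 0 γ) N 1) := by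
  set c := fluxLimit ω₂ γ with hc_def
  have hc : 0 < c := fluxLimit_pos hω hγ
  set C' := max C 1 with hC'_def
  set K' := max K 1 with hK'_def
  have hC'pos : 0 < C' := lt_of_lt_of_le one_pos (le_max_right C 1)
  have hK'pos : 0 < K' := lt_of_lt_of_le one_pos (le_max_right K 1)
  have hev1 : ∀ᶠ N : ℕ in atTop, c / 2 < fluxCoeff ω₂ γ N :=
    (tendsto_fluxCoeff hω hγ).eventually_const_lt (by linarith)
  have hev2 : ∀ᶠ N : ℕ in atTop, 2 ≤ N := eventually_ge_atTop 2
  have hev3 : ∀ᶠ N : ℕ in atTop, 64 * C' * K' / c ^ 2 < (N : ℝ) :=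
    (tendsto_natCast_atTop_atTop (R := ℝ)).eventually_gt_atTop _
  obtain ⟨N₀, hN₀⟩ := (hev1.and (hev2.and hev3)).exists_forall_of_atTop
  refine ⟨N₀, fun N hN u huL2 hJL2 hGK hK => ?_⟩
  obtain ⟨hN1, hN2, hN3⟩ := hN₀ N hN
  set Z := Zmass (pinnedChain ω₂ 0 0 γ) N 1 with hZ_def
  set f := fluxCoeff ω₂ γ N with hf_def
  have hZ : 0 < Z := Zmass_pos hω le_rfl le_rfl γ N one_pos
  have hN0 : (0 : ℝ) ≤ N := Nat.cast_nonneg N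
  have hN2r : (2 : ℝ) ≤ N := by exact_mod_cast hN2
  by_contra hnot
  have hbound : ∫ x, u x ^ 2 ∂(gibbsWeight (pinnedChain ω₂ 0 0 γ) N 1) ≤ C * (N : ℝ) ^ 2 * Z :=
    le_of_not_gt hnot
  -- Cauchy–Schwarz with the Green–Kubo value of the pairing
  have hCS := sq_integral_mul_le huL2 hJL2
  rw [hGK] at hCS
  have hu2 : ∫ x, u x ^ 2 ∂(gibbsWeight (pinnedChain ω₂ 0 0 γ) N 1) ≤ C' * (N : ℝ) ^ 2 * Z :=
    hbound.trans (mul_le_mul_of_nonneg_right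
      (mul_le_mul_of_nonneg_right (le_max_left C 1) (by positivity)) hZ.le)
  have hJK : ∫ x, Jtot (pinnedChain ω₂ 0 0 γ) N x ^ 2 ∂(gibbsWeight (pinnedChain ω₂ 0 0 γ) N 1) ≤
      K' * (N : ℝ) * Z :=
    hK.trans (mul_le_mul_of_nonneg_right
      (mul_le_mul_of_nonneg_right (le_max_left K 1) hN0) hZ.le)
  have hprod : (∫ x, u x ^ 2 ∂(gibbsWeight (pinnedChain ω₂ 0 0 γ) N 1)) *
      ∫ x, Jtot (pinnedChain ω₂ 0 0 γ) N x ^ 2 ∂(gibbsWeight (pinnedChain ω₂ 0 0 γ) N 1) ≤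
      (C' * (N : ℝ) ^ 2 * Z) * (K' * (N : ℝ) * Z) :=
    mul_le_mul hu2 hJK (integral_nonneg fun _ => sq_nonneg _) (by positivity)
  have e1 : (((N : ℝ) - 1) * 1 ^ 2 * (((N : ℝ) - 1) * f) * Z) ^ 2 = ((N : ℝ) - 1) ^ 4 * f ^ 2 * Z ^ 2 := by
    ring
  have e2 : (C' * (N : ℝ) ^ 2 * Z) * (K' * (N : ℝ) * Z) = C' * K' * (N : ℝ) ^ 3 * Z ^ 2 := by ring
  have key : ((N : ℝ) - 1) ^ 4 * f ^ 2 * Z ^ 2 ≤ C' * K' * (N : ℝ) ^ 3 * Z ^ 2 := by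
    rw [← e1, ← e2]; exact hCS.trans hprod
  have key' : ((N : ℝ) - 1) ^ 4 * f ^ 2 ≤ C' * K' * (N : ℝ) ^ 3 :=
    le_of_mul_le_mul_right key (pow_pos hZ 2)
  -- lower bound of the left side: f > c/2, N - 1 ≥ N/2
  have hf : c / 2 < f := hN1
  have hf2 : c ^ 2 / 4 ≤ f ^ 2 := by nlinarith
  have hN14 : ((N : ℝ) / 2) ^ 4 ≤ ((N : ℝ) - 1) ^ 4 :=
    pow_le_pow_left₀ (by positivity) (by linarith) 4
  have h3 : ((N : ℝ) / 2) ^ 4 * (c ^ 2 / 4) ≤ C' * K' * (N : ℝ) ^ 3 :=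
    (mul_le_mul hN14 hf2 (by positivity) (by positivity)).trans key'
  have h4 : ((N : ℝ) / 2) ^ 4 * (c ^ 2 / 4) = (N : ℝ) ^ 3 * ((N : ℝ) * c ^ 2 / 64) := by ring
  have h5 : C' * K' * (N : ℝ) ^ 3 = (N : ℝ) ^ 3 * (C' * K') := by ring
  rw [h4, h5] at h3
  have hN3pos : (0 : ℝ) < (N : ℝ) ^ 3 := by positivity
  have h6 : (N : ℝ) * c ^ 2 / 64 ≤ C' * K' := le_of_mul_le_mul_left h3 hN3pos
  have h7 : 64 * C' * K' < (N : ℝ) * c ^ 2 := by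
    have := hN3
    rw [div_lt_iff₀ (by positivity)] at this
    linarith
  linarith

/-- **The harmonic member of E1 is false, by Green–Kubo + ballistic flux alone** (load-bearing lemma
for `0 < lam ∧ 0 < β`, modulo the three Gaussian inputs H0–H2; the quantitative core is the
unconditional `harmonic_corrector_exceeds`). Exponent `3`, not `2`. -/
theorem coneScaleCorrectorHarmonic_false_of {ω₂ γ : ℝ} (hω : 0 < ω₂) (hγ : 0 < γ)
    (h0 : HarmonicCorrectorExists ω₂ γ) (h1 : HarmonicCorrectorGreenKubo ω₂ γ)
    (h2 : HarmonicTotalCurrentVariance ω₂ γ) : ¬ ConeScaleCorrectorHarmonic ω₂ γ := by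
  intro hE
  obtain ⟨C, hC⟩ := hE 1 one_pos
  obtain ⟨K, hK⟩ := h2 1 one_pos
  obtain ⟨N₀, hN₀⟩ := harmonic_corrector_exceeds hω hγ C K
  set N := max N₀ 2 with hN_def
  have hN0 : N₀ ≤ N := le_max_left _ _
  have hN2 : 2 ≤ N := le_max_right _ _
  obtain ⟨u, hu⟩ := h0 1 one_pos N hN2
  obtain ⟨huL2, hJL2, hGK⟩ := h1 1 one_pos N hN2 u hu
  obtain ⟨_, hbound⟩ := hC N u hu
  have hlt := hN₀ N hN0 u huL2 hJL2 hGK (hK N)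
  linarith

/-- Hence **any proof of E1 must use the anharmonicity `0 < lam ∧ 0 < β`** (given the Gaussian inputs):
the weakened crux is false. Which of `lam > 0` / `β > 0` ALONE suffices is open (`β = 0 < lam` is the
φ⁴ chain — numerically a normal conductor, NESS existence open for `N ≥ 4`; `lam = 0 < β` with
`ω₂ > 0` is the pinned FPU-β chain, also numerically normal). -/
theorem coneScaleCorrector_false_without_anharmonicity_of {ω₂ γ : ℝ} (hω : 0 < ω₂) (hγ : 0 < γ)
    (h0 : HarmonicCorrectorExists ω₂ γ) (h1 : HarmonicCorrectorGreenKubo ω₂ γ)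
    (h2 : HarmonicTotalCurrentVariance ω₂ γ) : ¬ ConeScaleCorrectorWithoutAnharmonicity := fun h =>
  coneScaleCorrectorHarmonic_false_of hω hγ h0 h1 h2 (coneScaleCorrectorHarmonic_of_without h hω hγ)

/-! ## §3 tightness from below: the Green–Kubo floor (exponent ≥ 1 under Fourier's law) -/

/-- **Green–Kubo floor** (abstract): if `∫ u J = A` and `∫ J² ≤ V` then `∫ u² ≥ A²/V`.
With `A = (N−1) T² D_N · Z` (CorrectorTheory clause B, unnormalised) and `V = K N Z`:
`∫ u² dμ_T ≥ (N−1)² T⁴ D_N² Z / (K N)`. Under Fourier's law (`D_N → κ(T) > 0`) this is `≍ N · Z`: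
E1's exponent cannot be lowered below `1`, and E1's `N²` sits exactly ONE power of `N` above the
floor — that power is the claimed deterministic causal window `t ≲ N/v_B`; for the harmonic chain
`D_N ≍ N` and the same floor is `≍ N³` (§2b). -/
theorem corrector_normSq_gk_floor {X : Type*} [MeasurableSpace X] {μ : Measure X} {u J : X → ℝ}
    (hu : MemLp u 2 μ) (hJ : MemLp J 2 μ) {A V : ℝ} (hA : ∫ x, u x * J x ∂μ = A) (hV : 0 < V)
    (hJV : ∫ x, J x ^ 2 ∂μ ≤ V) : A ^ 2 / V ≤ ∫ x, u x ^ 2 ∂μ := by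
  have hCS := sq_integral_mul_le hu hJ
  rw [hA] at hCS
  have h0 : 0 ≤ ∫ x, u x ^ 2 ∂μ := integral_nonneg fun _ => sq_nonneg _
  rw [div_le_iff₀ hV]
  calc A ^ 2 ≤ (∫ x, u x ^ 2 ∂μ) * ∫ x, J x ^ 2 ∂μ := hCS
    _ ≤ (∫ x, u x ^ 2 ∂μ) * V := mul_le_mul_of_nonneg_left hJV h0

/-- The floor in crux units: `∫ u J dμ_T = (N−1) T² D Z`, `∫ J² dμ_T ≤ K N Z`, `0 < K, N, Z` ⇒
`(N−1)² T⁴ D² / (K N) · Z ≤ ∫ u² dμ_T`. -/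
theorem corrector_normSq_ge_of_greenKubo {N : ℕ} {μ : Measure (PhaseSpace N)} {u J : PhaseSpace N → ℝ}
    (hu : MemLp u 2 μ) (hJ : MemLp J 2 μ) {T D K Z : ℝ} (hK : 0 < K) (hN : 0 < N) (hZ : 0 < Z)
    (hGK : ∫ x, u x * J x ∂μ = ((N : ℝ) - 1) * T ^ 2 * D * Z) (hJV : ∫ x, J x ^ 2 ∂μ ≤ K * N * Z) :
    ((N : ℝ) - 1) ^ 2 * T ^ 4 * D ^ 2 / (K * N) * Z ≤ ∫ x, u x ^ 2 ∂μ := by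
  have hN' : (0 : ℝ) < N := by exact_mod_cast hN
  have h := corrector_normSq_gk_floor hu hJ hGK (by positivity) hJV
  have e : (((N : ℝ) - 1) * T ^ 2 * D * Z) ^ 2 / (K * N * Z) =
      ((N : ℝ) - 1) ^ 2 * T ^ 4 * D ^ 2 / (K * N) * Z := by
    field_simp
  rw [← e]; exact h

/-! ## §4 the logical shape of a kill and of the strengthening's death: equilibrium floors

`CorrectorFloor ω₂ lam β γ T k c`: from some `N₀` on, correctors EXIST and every corrector has
`∫ u² dμ_T ≥ c N^k Z`. Then:
* floor with exponent `3` ⇒ ¬E1 (kill criterion (a′) of the route: "the corrector keeps memory for ≍ N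
  causal crossings"; the harmonic chain has it, §2b; the replica numerics of this seat measure
  `B(τ) = ‖u_τ‖²_π ≤ 4‖u‖²_π` directly — kit jobs in the header);
* floor with exponent `2` (the route's OWN causal-window heuristic `‖u‖² ≳ σ² N²/(2v_B)`, deterministic
  bulk) ⇒ the natural strengthening `ConeScaleCorrectorPow 1` ("stochastic-bulk scale", which WOULD give
  bounded response by one Cauchy–Schwarz against `J`) is false — consistent with E1 being stated at `N²`. -/

/-- Equilibrium floor of exponent `k` and constant `c` on the open-chain Kubo corrector. -/
def CorrectorFloor (ω₂ lam β γ T : ℝ) (k : ℕ) (c : ℝ) : Prop :=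
  ∃ N₀ : ℕ, ∀ N : ℕ, N₀ ≤ N →
    (∃ u : PhaseSpace N → ℝ, IsCorrectorLimit (pinnedChain ω₂ lam β γ) N T u) ∧
    ∀ u : PhaseSpace N → ℝ, IsCorrectorLimit (pinnedChain ω₂ lam β γ) N T u →
      c * (N : ℝ) ^ k * Zmass (pinnedChain ω₂ lam β γ) N T ≤
        ∫ x, (u x) ^ 2 ∂(gibbsWeight (pinnedChain ω₂ lam β γ) N T)

/-- **A floor of exponent `k+1` at one admissible parameter point kills `ConeScaleCorrectorPow k`.** -/
theorem coneScaleCorrectorPow_false_of_floor {ω₂ lam β γ T : ℝ} (hω : 0 < ω₂) (hl : 0 < lam)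
    (hβ : 0 < β) (hγ : 0 < γ) (hT : 0 < T) {k : ℕ} {c : ℝ} (hc : 0 < c)
    (hF : CorrectorFloor ω₂ lam β γ T (k + 1) c) : ¬ ConeScaleCorrectorPow k := by
  intro hE
  obtain ⟨C, hC⟩ := hE ω₂ lam β γ hω hl hβ hγ T hT
  obtain ⟨N₀, hN₀⟩ := hF
  set C' := max C 1 with hC'_def
  have hC'pos : 0 < C' := lt_of_lt_of_le one_pos (le_max_right C 1)
  have hev1 : ∀ᶠ N : ℕ in atTop, N₀ ≤ N := eventually_ge_atTop N₀
  have hev2 : ∀ᶠ N : ℕ in atTop, 1 ≤ N := eventually_ge_atTop 1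
  have hev3 : ∀ᶠ N : ℕ in atTop, C' / c < (N : ℝ) :=
    (tendsto_natCast_atTop_atTop (R := ℝ)).eventually_gt_atTop _
  obtain ⟨N, hN1, hN2, hN3⟩ := (hev1.and (hev2.and hev3)).exists
  obtain ⟨⟨u, hu⟩, hfl⟩ := hN₀ N hN1
  obtain ⟨_, hbound⟩ := hC N u hu
  have hfloor := hfl u hu
  set Z := Zmass (pinnedChain ω₂ lam β γ) N T with hZ_def
  have hZ : 0 < Z := Zmass_pos hω hl.le hβ.le γ N hT
  have hN1r : (1 : ℝ) ≤ N := by exact_mod_cast hN2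
  have hNk : (0 : ℝ) < (N : ℝ) ^ k := by positivity
  have h1 : c * (N : ℝ) ^ (k + 1) * Z ≤ C' * (N : ℝ) ^ k * Z :=
    (hfloor.trans hbound).trans (mul_le_mul_of_nonneg_right
      (mul_le_mul_of_nonneg_right (le_max_left C 1) hNk.le) hZ.le)
  have h2 : c * (N : ℝ) ^ (k + 1) ≤ C' * (N : ℝ) ^ k := le_of_mul_le_mul_right h1 hZ
  have h3 : (c * (N : ℝ)) * (N : ℝ) ^ k ≤ C' * (N : ℝ) ^ k := by
    have e : c * (N : ℝ) ^ (k + 1) = (c * (N : ℝ)) * (N : ℝ) ^ k := by ring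
    rwa [e] at h2
  have h4 : c * (N : ℝ) ≤ C' := le_of_mul_le_mul_right h3 hNk
  have h5 : C' < c * (N : ℝ) := by
    have := hN3
    rw [div_lt_iff₀ hc] at this
    linarith
  linarith

/-- KILL SHAPE (a′): an equilibrium `N³`-floor on the Kubo corrector at one admissible parameter point
refutes E1. (What the replica numerics test: `B(τ)/N² = ‖u_τ‖²_π/N²` growing `∝ N` at the plateau,
for `N ≫ ℓ(T)`.) -/
theorem coneScaleCorrector_false_of_cubicFloor {ω₂ lam β γ T c : ℝ} (hω : 0 < ω₂) (hl : 0 < lam)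
    (hβ : 0 < β) (hγ : 0 < γ) (hT : 0 < T) (hc : 0 < c) (hF : CorrectorFloor ω₂ lam β γ T 3 c) :
    ¬ ConeScaleCorrector :=
  coneScaleCorrector_iff_pow_two.not.mpr (coneScaleCorrectorPow_false_of_floor hω hl hβ hγ hT hc hF)

/-- STRENGTHENING REFUTED MODULO THE CONE FLOOR: the `N¹` ("stochastic-bulk") version of E1 dies under an
equilibrium `N²`-floor — the route's own reading of the deterministic causal window
(`‖u‖²_π ≳ σ² N · N/(2 v_B)`: the two-sided cone transport is `X_0`-measurable). -/
theorem coneScaleCorrectorLinear_false_of_coneFloor {ω₂ lam β γ T c : ℝ} (hω : 0 < ω₂) (hl : 0 < lam)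
    (hβ : 0 < β) (hγ : 0 < γ) (hT : 0 < T) (hc : 0 < c) (hF : CorrectorFloor ω₂ lam β γ T 2 c) :
    ¬ ConeScaleCorrectorPow 1 :=
  coneScaleCorrectorPow_false_of_floor hω hl hβ hγ hT hc hF


/-! ## §5 WHY IT RESISTS — the echo identity (the mechanism behind `N²` vs `N³`, stated abstractly)

For the equilibrium open chain, generalised detailed balance `P_t† = Θ P_t Θ` on `L²(π)` (KDN (reln2);
the dictionary `OddSectorLocalityHypothesis` of the landed negative lemma FalseOfLocality) turns the
corrector norm into an imperfect LOSCHMIDT ECHO of the current: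
`‖u‖²_π = ‖RJ‖² = −⟨J, R Θ R J⟩_π = −∫₀^∞∫₀^∞ ⟨J, P_s Θ P_t J⟩_π ds dt`, `R = ∫₀^∞ P_t dt`, i.e.
`E_π[J(X_0) · (−J)(X'_t)]` where `X'` restarts from the momentum-FLIPPED state `ΘX_s` with fresh bath
noise. A deterministic bulk retraces itself (`X'_t = ΘX_{s−t}` on every bond the boundary discrepancy —
friction of the wrong sign plus fresh noise, an `O(1)` perturbation — has not yet reached), so each bond
`i` contributes its full two-sided Green–Kubo integral `σ² = Σ_j ∫_ℝ ⟨j_j(0) j_i(τ)⟩dτ = 2κT²` for as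
long as its echo survives: `‖u‖²_π ≈ σ² Σ_i τ_echo(i)`.
* chaotic bulk (the bet of E1): the discrepancy front moves at the butterfly speed `v_B > 0` and
  scrambles everything behind it ⇒ `τ_echo(i) ≈ d_i / v_B`, `‖u‖²_π ≈ 2κT² · N²/(4 v_B)` — exponent 2,
  constant `C(T) ≈ κ(T) T²/(2 v_B(T))` (blows up in the cold corner like the mean free path, consistent
  with `∃ C(T)`); the hydrodynamic remainder (energy profile × exit probabilities) is `O(N)` because the
  exit probabilities of a diffusive conductor are affine in the position (exact cancellation of the
  `N³` energy-dipole variance `‖G − πG‖²`, `G = Σ k e_k`, against `(N−1)·E_x[Q_R]` in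
  `u = πG − G − (N−1) ∫₀^∞ P_t w_R`, tree: `sum_bondCurrent_eq_poisson`).
* harmonic bulk: the discrepancy is a linear wave that scrambles nothing; the echo of each phonon decays
  only through boundary absorption (lifetime `≳ N`, band edges up to `≍ N³`: Piazza–Lepri–Livi 2001,
  arXiv:nlin/0105028, abstract — open harmonic chain with boundary baths: "crossover from an exponential
  to an inverse-square-root law on a time scale ∝ N … back to an exponential law only at much longer times
  (of the order N³)") ⇒ `‖u‖² ≍ N³` (§2b makes the exponent-3 floor rigorous modulo Gaussian inputs, via
  Green–Kubo + ballistic flux).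
So ¬E1 at admissible parameters needs a POSITIVE-measure set of Gibbs states whose current echo
survives `≫ N/v_B` — an odd quasi-conserved ballistic mode (none: pinning kills momentum conservation,
the family has no integrable member with `lam, β > 0`) or sub-ballistic scrambling (never observed in
chaotic lattices; fronts are ballistic with `v_B ≈ 0.4` at `(1,1,1,1), T = 1`, measured on item 9139).
Conversely a PROOF of E1 must show that two boundary taps destroy the current echo of a deterministic
anharmonic bulk in `O(1)` crossings, in `L²(Gibbs)` mean — a quantitative chaoticity statement for which
no rigorous tool exists for any FPU/φ⁴-type chain (cf. barrier entries SpectralGapClosing*,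
LowTemperatureWeakAnharmonicity: every printed rate statement is either fixed-N or harmonic/stochastic).
The identity itself is three lines of Hilbert-space algebra: -/

section Echo

variable {E : Type*} [NormedAddCommGroup E] [InnerProductSpace ℝ E] [CompleteSpace E]

open ContinuousLinearMap in
/-- **Echo identity.** On a real Hilbert space let `Θ` be self-adjoint (the momentum flip,
`(Θf)(q,p) = f(q,−p)`, unitary on `L²(π)` because `π` is `Θ`-invariant), `R` an operator with the
generalised detailed balance `R† = Θ R Θ` (the resolvent `∫₀^∞ P_t dt` of a `Θ`-reversible semigroup)
and `J` odd (`ΘJ = −J`, the current). Then `‖RJ‖² = −⟪J, R Θ R J⟫`: the squared norm of the Kubo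
corrector is minus the flip-echo pairing of the current. [folklore] -/
theorem echo_identity (R Θ : E →L[ℝ] E) (hΘadj : adjoint Θ = Θ)
    (hR : adjoint R = (Θ.comp R).comp Θ) (J : E) (hJ : Θ J = -J) :
    ‖R J‖ ^ 2 = -inner ℝ J (R (Θ (R J))) := by
  have h1 : ‖R J‖ ^ 2 = inner ℝ (R J) (R J) := (real_inner_self_eq_norm_sq (R J)).symm
  have h2 : inner ℝ (R J) (R J) = inner ℝ J (adjoint R (R J)) :=
    (adjoint_inner_right R J (R J)).symm
  have h3 : adjoint R (R J) = Θ (R (Θ (R J))) := by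
    rw [hR]; rfl
  have h4 : inner ℝ J (Θ (R (Θ (R J)))) = inner ℝ (Θ J) (R (Θ (R J))) := by
    have := adjoint_inner_left Θ (R (Θ (R J))) J
    rw [hΘadj] at this
    exact this.symm
  rw [h1, h2, h3, h4, hJ, inner_neg_left]

end Echo

/-! ## §6 NUMERICS — kill criterion (a′) run by this seat: E1 survives; the estimator reproduces the harmonic `N³`

Replica estimator (script `kitjob1/cone_scale.py` in the seat folder; evidence `compute-<job>.json` +
`NUMERICS-*.md` on the item): `X_0 ~ π_T` (all-site Langevin burn-in, BAOAB, `dt = 0.015`), then `R`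
replicas from the SAME `X_0` with INDEPENDENT boundary noises; `Y^r_τ = ∫₀^τ J_tot(X^r_t)dt`;
U-statistic `B(τ) = E[Y^r_τ Y^{r'}_τ]_{r≠r'} = E_π[(E[Y_τ|X_0])²] = ‖u_τ‖²_π` (finite-horizon corrector;
`‖u‖²_π ≥ B(τ)/4` for every `τ` since `P_τ` contracts `L²(π)`; in crux units `∫u_τ²dμ_T/Z = B(τ)`).
Also: desynchronisation profile `d_i(τ) = E(p¹_i−p²_i)²/2T` (scrambling front), `A(τ) = E Y_τ²`
(Einstein–Helfand; `A/((N−1)τ)` = running Green–Kubo integral `σ²(τ)` while `τ ≲ N`).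

HARMONIC CONTROL `(1,0,0,1), T = 1` (exact answer `‖u‖² ≍ N³`): `B(3N)/N² = 3.06 ± 0.37 (N=16)`,
`11.9 ± 1.1 (N=64)` — slope **2.98**: the estimator sees the exponent 3; the replicas never desynchronise
(`d_mid ≤ 0.63` at `τ = 3N`: a linear bulk scrambles nothing, §5).

HOT POINT `(ω₂,lam,β,γ) = (1,1,1,1)`, `T = 10` — `B/N²` at `τ/N = 0.25 / 0.5 / 0.75 / 1 / 2 / end`:
| job | `N` | `S×R` | `B/N²` trajectory | plateau `B/N²` | `σ²(τ≈N)` | `‖J‖²/(NZ)` |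
|---|---|---|---|---|---|---|
| j012827 | 16 | 500×8 | 65 / 153 / 178 / 170 / 139 / 130 (3N) | 178 → 130 (overshoot) | 650 | 126 |
| j012827 | 32 | 500×8 | 118 / 289 / 378 / 372 / 334 / 331 (3N) | ≈ 350 ± 40 | 1140 | 107 |
| j012827 | 64 | 500×8 | 205 / 493 / 592 / 573 / 512 / 550 (3N) | ≈ 550 ± 60 | 1730 | 107 |
| j012822 | 128 | 375×8 | 371 / 738 / 860 / 846 / 861 / 850 (2.67N) | **852 ± 110** (flat ±2 % over τ/N ∈ [0.75, 2.67]) | 2600 | 135 |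
| j012823 | 256 | 250×8 | 475 / 842 / 920 / — / — / 923 (0.91N) | **≈ 920 ± 104** | 3180 | 119 |
| j012824 | 512 | 100×6 | 542 / 847 / 738 / — / — / 740 (0.76N) | **≈ 790 ± 160** | 3360 | 113 |
| j014719 | 1024 | 240×6 (4 tasks) | 714 / 910 / 811 (0.75N) / — / — / 811 | **≈ 860 ± 100** | 3820 (converged from τ ≈ 0.4N) | 112 |

READING. (i) MECHANISM CONFIRMED: `B(τ)/N²` rises while the bulk transport is deterministic and stops
rising exactly when the desynchronisation front (speed `v_B ≈ 1.2` sites per unit time) reaches mid-chain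
(`τ ≈ 0.45N`, `d_mid → 1`); thereafter flat (N = 128: ±2 % from `0.75N` to `2.67N`). The two taps
scramble the deterministic bulk in ONE causal crossing — §5 verbatim. (ii) EXPONENT: local slopes
`d log B / d log N = 3.35, 2.73, 2.63, 2.12, 1.68, 2.1` on `[16,32], …, [512,1024]` — DEcreasing to 2;
the plateau values `852 / 920 / 790 / 860` for `N = 128 / 256 / 512 / 1024` are `N`-INDEPENDENT (flat
over a factor 8) within the 12 % errors. Exponent 3 would give `6800` at `N = 1024`, exponent 2.5 `2400`,
`N² log N` `1220`: all excluded (the last at ≈ 3.5σ).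
(iii) The small-`N` growth is the running Green–Kubo integral: `σ²(τ) = A/((N−1)τ)` at `τ ≈ N` is
`650, 1140, 1730, 2600, 3180, 3360` and CONVERGES to `σ²_∞ ≈ 3.8·10³` (flat from `τ ≈ 400` in the
`N = 1024` run) with `t^{−1/2}`-type increments (the `t^{−3/2}` hydrodynamic current tail of a NORMAL 1-d
conductor); the plateau is `B/N² ≈ σ²_∞/(4 v_B) = 3800/4.6 ≈ 830` — the echo estimate of §5 ON THE NOSE
(measured 850 ± 100). So the finite-size drift of `B/N²` below `N ≈ 128` is the GK integral's, not extra
memory, and there is no drift above. (iv) No loophole is left at this point at the 12 % level: `N² log N`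
is excluded at 3.5σ, and `κ_GK(T=10)` is numerically finite. (v) CONSTANT: `C(T=10) ≈ 0.85–0.9·10³ ≈
7.5 ‖J‖²/(NZ) ≈ 0.23 σ²_∞` (`‖u_N‖_π ≈ 2.7 √N ‖J‖_π`). COLD `T = 1` (same couplings), `N = 128`
(j012829): plateau `B/N² ≈ 13–14 ≈ 37 ‖J‖²/(NZ)` reached at `τ ≈ N` (front `v_B ≈ 0.8`), still
creeping +7 % by `2.2N` — the cold corner has the larger constant, as E1's `∃ C(T)` anticipates.
`N`-dependence at `T = 1` (j014720, j012829): plateau `B/N² ≈ 9.1 ± 0.7 (N=64), 13.4 ± 1.3 (128),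
17.8 ± 2.1 (256)` — STILL GROWING (local slopes of `B`: 2.56, 2.41), but in lock-step with the
UNCONVERGED running Green–Kubo integral `σ²(τ≈N) = 14.0, 21.3, 31.5` (`B/N² ≈ 0.6 σ²(N)` at all three
`N`): at `T = 1` the chain is pre-asymptotic up to `N = 256` (current autocorrelation time ≳ 10², the
weak-anharmonicity corner of the ALS scaling), so this point cannot test E1's exponent — it tests only
that the corrector is the GK integral up to one crossing, which it confirms. Whether `B/N²` saturates
at `T = 1` is the same question as `κ_GK(T=1) < ∞`.

SECOND ANHARMONIC POINT `(1,1,0.1,1)`, `T = 8` (φ⁴-like: weak quartic coupling; jobs j012828, j012829) —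
here the running GK integral has CONVERGED by `τ ≈ N` (`σ²(τ≈N) = 99, 112, 118, 116`), so no finite-size
drift is expected, and none is seen:
| `N` | `S×R` | `B/N²` at `τ/N = 0.37 / 0.63 / 0.88 / 1.1 / 2.1 / end` | plateau `B/N²` | `‖J‖²/(NZ)` |
|---|---|---|---|---|
| 32 | 500×8 | 23.4 / 40.7 / 50.1 / 54.8 / 50.0 / 54.7 (3N) | **52 ± 5** | 11.5 |
| 64 | 500×8 | 32.2 / 47.0 / 53.8 / 53.5 / 55.3 / 60.8 (3N) | **55 ± 5** | 11.6 |
| 128 | 375×8 | 34.2 / 48.8 / 52.6 / 51.3 / 51.8 / 54.6 (2.6N) | **52 ± 5** | 11.2 |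
| 256 | 250×8 | 33.7 / 46.3 / 50.4 (0.86N) / — / — / 50.4 | **≈ 51 ± 5** | 12.1 |
Plateau `≈ 52 ± 5 ≈ 4.5 ‖J‖²/(NZ)`, FLAT over a factor 8 in `N` (log–log slope of `B`: **1.95**; pairwise
2.15, 1.84, 1.89); a `log N` growth (×1.6 over this range) is excluded at > 5σ here; fronts `v_B ≈ 0.6`,
plateau reached at `τ ≈ 0.9N ≈ N/(2v_B)` — one crossing again.

VERDICT OF (a′): does NOT fire at either asymptotic anharmonic point; the estimator reproduces the harmonic
exponent 3; E1 behaves exactly as the route's heuristic says, at the true scale `N²`, with the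
one-crossing scrambling mechanism directly visible in the desynchronisation front.
-/

-- Targets: none yet (payload.targets = [] at cycle 1; the lead has not picked a line).

end Summit.AtomisticToContinuum.FouriersLaw.Cruxes.ConeScaleCorrector.Disproof
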